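import Summits.FinalStateConjecture.FinalStateConjecture.Theorems.EIHFluxBalanceModulatedKerrHandoffOneHoleKernel

/-!
# Route EIHFluxBalance — `ModulatedKerrHandoff`, stub `stub_oneHoleMatching`: the parameter box

The scaled rest-frame positions stay in a compact parameter box.

Helper file for the crux `stmt-FinalStateConjecture-10167`
(`Summit.FinalStateConjecture.FinalStateConjecture.Theses.EIHFluxBalance.ModulatedKerrHandoff`),
line `photon-rocket-modulation`, stub `stub_oneHoleMatching` (one-hole profile matching).

The kernel bounds of `…OneHoleKernel` are uniform on parameter boxes
`{|a′| ≤ a_b, ‖w‖ ≤ R_b, r_b ≤ r_{a′}(0, w)}`. The matching evaluates the kernel at the SCALED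
rest-frame positions `w = ε Y`, `ε = (max 1 d)⁻¹`, `d` the lab distance of the point to the centre,
for `Y` on the segment between the instantaneous position `Y₀` (`d ≤ ‖Y₀‖ ≤ (1 + 3γ) d`, rest-frame
Kerr–Schild radius `> rin`) and the retarded one `Y₁`. This file proves that these scaled positions
lie in ONE box, with spin `ε a`:

* `exists_box_segment` — if `‖Y₁ − Y₀‖ ≤ ϑ₀ d` (the tame regime supplies this for late times), the
  whole segment qualifies: far from the hole (`d ≥ 4|a|`, `d ≥ 1`) because `‖εY‖ ≥ 1/2` dominates the
  scaled spin `|εa| ≤ 1/4` (`r² ≥ ‖w‖² − a′²`), near the hole by UNIFORM CONTINUITY of the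
  Kerr–Schild radius on a compact ball and its homogeneity `r_{εa}(0, εY) = ε r_a(0, Y)`
  (`Kerr.radius_smul`);
* `box_far_inst`, `box_far_ret` — far from the hole each endpoint qualifies on its own
  (`‖εY₀‖ ∈ [1, 1 + 3γ]`; `‖εY₁‖ ∈ [(1−v)/(1+v), 2(1+3γ)/(1−v)]` from the null retarded separation).
-/

noncomputable section

-- `Summit.<S>.<S>.…` (single-problem summit, D-0017) trips core's duplicate-namespace linter.
set_option linter.dupNamespace false

open Set Filter Function Metric Literature.Geometry.Lorentzian
open scoped Topology

namespace Summit.FinalStateConjecture.FinalStateConjecture.Theorems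

namespace OneHole

/-- Scaling commutes with the rest-frame slice embedding: `ε • (0, w) = (0, ε • w)`. [folklore] -/
theorem smul_ofTimeSpace_zero (ε : ℝ) (w : E3) : ε • E4.ofTimeSpace 0 w = E4.ofTimeSpace 0 (ε • w) := by
  ext i
  refine Fin.cases ?_ (fun j ↦ ?_) i <;> simp

/-- **Homogeneity of the rest-frame radius**: `r_{εa}(0, ε w) = ε r_a(0, w)` for `ε > 0`
(`Kerr.radius_smul`; Visser arXiv:0706.0622, (35)). [folklore] -/
theorem radius_slice_smul {ε : ℝ} (hε : 0 < ε) (a : ℝ) (w : E3) :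
    Kerr.radius (ε * a) (E4.ofTimeSpace 0 (ε • w)) = ε * Kerr.radius a (E4.ofTimeSpace 0 w) := by
  rw [← smul_ofTimeSpace_zero, Kerr.radius_smul hε]

/-- A lower bound for the rest-frame radius from `r² ≥ ‖w‖² − a′²`: if `ℓ ≤ ‖w‖` and `|a′| ≤ ℓ/2`
(`ℓ ≥ 0`) then `ℓ/2 ≤ r_{a′}(0, w)`. [folklore] -/
theorem half_le_radius_slice {a' ℓ : ℝ} {w : E3} (hℓ : 0 ≤ ℓ) (hw : ℓ ≤ ‖w‖) (ha : |a'| ≤ ℓ / 2) :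
    ℓ / 2 ≤ Kerr.radius a' (E4.ofTimeSpace 0 w) := by
  have h := sq_sub_sq_le_radius_slice_sq a' w
  have hr := Kerr.radius_nonneg a' (E4.ofTimeSpace 0 w)
  have ha2 : a' ^ 2 ≤ (ℓ / 2) ^ 2 := by
    rw [← sq_abs]; exact pow_le_pow_left₀ (abs_nonneg _) ha 2
  have hw2 : ℓ ^ 2 ≤ ‖w‖ ^ 2 := pow_le_pow_left₀ hℓ hw 2
  nlinarith

/-! ### Far from the hole: each endpoint on its own -/

/-- **Far box, instantaneous endpoint**: if `d ≥ max 1 (4|a|)` and `d ≤ ‖Y₀‖ ≤ (1 + 3γ) d` then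
`‖d⁻¹ Y₀‖ ≤ 1 + 3γ` and `r_{a/d}(0, d⁻¹Y₀) ≥ 1/2`. [folklore] -/
theorem box_far_inst {a γ d : ℝ} {Y₀ : E3} (hd : max 1 (4 * |a|) ≤ d) (h1 : d ≤ ‖Y₀‖)
    (h2 : ‖Y₀‖ ≤ (1 + 3 * γ) * d) :
    ‖d⁻¹ • Y₀‖ ≤ 1 + 3 * γ ∧ 1 / 2 ≤ Kerr.radius (d⁻¹ * a) (E4.ofTimeSpace 0 (d⁻¹ • Y₀)) := by
  have hd1 : 1 ≤ d := (le_max_left _ _).trans hd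
  have hd0 : 0 < d := one_pos.trans_le hd1
  have hda : 4 * |a| ≤ d := (le_max_right _ _).trans hd
  have hn : ‖d⁻¹ • Y₀‖ = d⁻¹ * ‖Y₀‖ := by rw [norm_smul, Real.norm_eq_abs, abs_of_pos (inv_pos.mpr hd0)]
  constructor
  · rw [hn, inv_mul_le_iff₀ hd0]; linarith
  · refine half_le_radius_slice zero_le_one ?_ ?_
    · rw [hn, le_inv_mul_iff₀ hd0]; linarith
    · rw [abs_mul, abs_of_pos (inv_pos.mpr hd0), inv_mul_le_iff₀ hd0]; linarith

/-- **Far box, retarded endpoint**: with `Δ` the retardation, `(1 − v)Δ ≤ d ≤ (1 + v)Δ`,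
`(1 − v)Δ ≤ ‖Y₁‖ ≤ 2(1 + 3γ)Δ` and `d ≥ max 1 (2|a|(1 + v)/(1 − v))`:
`‖d⁻¹Y₁‖ ≤ 2(1 + 3γ)/(1 − v)` and `r_{a/d}(0, d⁻¹Y₁) ≥ (1 − v)/(2(1 + v))`. [folklore] -/
theorem box_far_ret {a γ v d Δ : ℝ} {Y₁ : E3} (hγ : 0 ≤ γ) (hv0 : 0 ≤ v) (hv1 : v < 1)
    (hd : max 1 (2 * |a| * (1 + v) / (1 - v)) ≤ d) (hΔ1 : (1 - v) * Δ ≤ d) (hΔ2 : d ≤ (1 + v) * Δ)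
    (h1 : (1 - v) * Δ ≤ ‖Y₁‖) (h2 : ‖Y₁‖ ≤ 2 * (1 + 3 * γ) * Δ) :
    ‖d⁻¹ • Y₁‖ ≤ 2 * (1 + 3 * γ) / (1 - v) ∧
      (1 - v) / (1 + v) / 2 ≤ Kerr.radius (d⁻¹ * a) (E4.ofTimeSpace 0 (d⁻¹ • Y₁)) := by
  have hd1 : 1 ≤ d := (le_max_left _ _).trans hd
  have hd0 : 0 < d := one_pos.trans_le hd1
  have h1v : 0 < 1 - v := by linarith
  have h1v' : 0 < 1 + v := by linarith
  have hΔ0 : 0 < Δ := by nlinarith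
  have hn : ‖d⁻¹ • Y₁‖ = d⁻¹ * ‖Y₁‖ := by rw [norm_smul, Real.norm_eq_abs, abs_of_pos (inv_pos.mpr hd0)]
  have hΔd : Δ ≤ d / (1 - v) := by rw [le_div_iff₀ h1v]; linarith
  have hdΔ : d / (1 + v) ≤ Δ := by rw [div_le_iff₀ h1v']; linarith
  constructor
  · rw [hn, inv_mul_le_iff₀ hd0]
    calc ‖Y₁‖ ≤ 2 * (1 + 3 * γ) * Δ := h2
      _ ≤ 2 * (1 + 3 * γ) * (d / (1 - v)) := mul_le_mul_of_nonneg_left hΔd (by positivity)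
      _ = d * (2 * (1 + 3 * γ) / (1 - v)) := by ring
  · refine half_le_radius_slice (div_nonneg h1v.le h1v'.le) ?_ ?_
    · rw [hn, le_inv_mul_iff₀ hd0]
      calc d * ((1 - v) / (1 + v)) = (1 - v) * (d / (1 + v)) := by ring
        _ ≤ (1 - v) * Δ := mul_le_mul_of_nonneg_left hdΔ h1v.le
        _ ≤ ‖Y₁‖ := h1
    · have hda : 2 * |a| * (1 + v) / (1 - v) ≤ d := (le_max_right _ _).trans hd
      rw [div_le_iff₀ h1v] at hda
      rw [abs_mul, abs_of_pos (inv_pos.mpr hd0), inv_mul_le_iff₀ hd0, div_div, mul_div_assoc',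
        le_div_iff₀ (by positivity)]
      nlinarith [abs_nonneg a]

/-! ### Segments: uniform continuity of the rest-frame radius near the hole -/

/-- **Uniform continuity of the rest-frame radius on balls**: for `R` and `η > 0` there is `δ ∈ (0, 1]`
with `|r_a(0, w) − r_a(0, w′)| ≤ η` whenever `‖w‖, ‖w′‖ ≤ R`, `‖w − w′‖ ≤ δ` (continuity of
`Kerr.radius` on a compact ball). [folklore] -/
theorem exists_radius_slice_uniform (a R : ℝ) {η : ℝ} (hη : 0 < η) :
    ∃ δ : ℝ, 0 < δ ∧ δ ≤ 1 ∧ ∀ w w' : E3, ‖w‖ ≤ R → ‖w'‖ ≤ R → ‖w - w'‖ ≤ δ →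
      |Kerr.radius a (E4.ofTimeSpace 0 w) - Kerr.radius a (E4.ofTimeSpace 0 w')| ≤ η := by
  have hc : Continuous fun w : E3 ↦ Kerr.radius a (E4.ofTimeSpace 0 w) :=
    (Kerr.continuous_radius a).comp (E4.continuous_ofTimeSpace 0)
  have hu := (isCompact_closedBall (0 : E3) R).uniformContinuousOn_of_continuous hc.continuousOn
  obtain ⟨δ, hδ0, hδ⟩ := (Metric.uniformContinuousOn_iff_le.mp hu) η hη
  refine ⟨min δ 1, lt_min hδ0 one_pos, min_le_right _ _, fun w w' hw hw' hww ↦ ?_⟩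
  have h := hδ w (mem_closedBall_zero_iff.mpr hw) w' (mem_closedBall_zero_iff.mpr hw')
    (by rw [dist_eq_norm]; exact hww.trans (min_le_left _ _))
  rwa [Real.dist_eq] at h

/-- **The box lemma for segments.** Given the spin `a`, a core radius `rin > 0` and `γ ≥ 0`, there are
`ϑ₀ > 0`, `r_b > 0` and `R_b` such that: whenever `0 ≤ d ≤ ‖Y₀‖ ≤ (1 + 3γ)d`, `r_a(0, Y₀) > rin` and
`‖Y₁ − Y₀‖ ≤ ϑ₀ d`, every scaled point `ε(Y₀ + s(Y₁ − Y₀))` (`s ∈ [0,1]`, `ε = (max 1 d)⁻¹`) has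
norm `≤ R_b` and rest-frame radius `r_{εa} ≥ r_b`. [folklore] -/
theorem exists_box_segment (a : ℝ) {rin γ : ℝ} (hrin : 0 < rin) (hγ : 0 ≤ γ) :
    ∃ ϑ₀ rb Rb : ℝ, 0 < ϑ₀ ∧ ϑ₀ ≤ 1 / 2 ∧ 0 < rb ∧ ∀ (Y₀ Y₁ : E3) (d : ℝ), 0 ≤ d → d ≤ ‖Y₀‖ →
      ‖Y₀‖ ≤ (1 + 3 * γ) * d → rin < Kerr.radius a (E4.ofTimeSpace 0 Y₀) → ‖Y₁ - Y₀‖ ≤ ϑ₀ * d →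
      ∀ s ∈ Icc (0 : ℝ) 1,
        ‖(max 1 d)⁻¹ • (Y₀ + s • (Y₁ - Y₀))‖ ≤ Rb ∧
          rb ≤ Kerr.radius ((max 1 d)⁻¹ * a) (E4.ofTimeSpace 0 ((max 1 d)⁻¹ • (Y₀ + s • (Y₁ - Y₀)))) := by
  set Da : ℝ := max 1 (4 * |a|) with hDa
  have hDa1 : 1 ≤ Da := le_max_left _ _
  have hDa0 : 0 < Da := one_pos.trans_le hDa1
  obtain ⟨δ, hδ0, hδ1, hδ⟩ := exists_radius_slice_uniform a ((1 + 3 * γ) * Da + 1) (half_pos hrin)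
  refine ⟨min (1 / 2) (δ / Da), min (1 / 4) (rin / (2 * Da)), 2 + 3 * γ, lt_min one_half_pos
    (div_pos hδ0 hDa0), min_le_left _ _, lt_min (by norm_num) (by positivity), ?_⟩
  intro Y₀ Y₁ d hd0 hdY hYd hρ hϑ s hs
  set ε : ℝ := (max 1 d)⁻¹ with hε
  set Ys : E3 := Y₀ + s • (Y₁ - Y₀) with hYs
  have hm1 : 1 ≤ max 1 d := le_max_left _ _
  have hm0 : 0 < max 1 d := one_pos.trans_le hm1
  have hε0 : 0 < ε := inv_pos.mpr hm0
  have hε1 : ε ≤ 1 := inv_le_one_of_one_le₀ hm1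
  have hϑ' : ‖Y₁ - Y₀‖ ≤ 1 / 2 * d := hϑ.trans (mul_le_mul_of_nonneg_right (min_le_left _ _) hd0)
  have hYs0 : ‖Ys - Y₀‖ ≤ ‖Y₁ - Y₀‖ := by
    rw [hYs, add_sub_cancel_left, norm_smul, Real.norm_eq_abs, abs_of_nonneg hs.1]
    exact mul_le_of_le_one_left (norm_nonneg _) hs.2
  have hnε : ‖ε • Ys‖ = ε * ‖Ys‖ := by rw [norm_smul, Real.norm_eq_abs, abs_of_pos hε0]
  have hYs_le : ‖Ys‖ ≤ (1 + 3 * γ) * d + 1 / 2 * d := by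
    have := norm_le_norm_sub_add Ys Y₀; linarith
  have hYs_ge : d - 1 / 2 * d ≤ ‖Ys‖ := by
    have := norm_le_norm_sub_add Y₀ Ys; rw [norm_sub_rev] at this; linarith
  -- the norm bound
  have hnorm : ‖ε • Ys‖ ≤ 2 + 3 * γ := by
    rw [hnε]
    rcases le_or_gt d 1 with hd1 | hd1
    · have hεeq : ε = 1 := by rw [hε, max_eq_left hd1, inv_one]
      rw [hεeq, one_mul]
      nlinarith
    · have hεeq : ε = d⁻¹ := by rw [hε, max_eq_right hd1.le]
      rw [hεeq, inv_mul_le_iff₀ (by linarith)]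
      nlinarith
  refine ⟨hnorm, ?_⟩
  -- the radius bound
  rcases le_or_gt d Da with hdD | hdD
  · -- near: uniform continuity
    have hclose : ‖Ys - Y₀‖ ≤ δ := by
      refine (hYs0.trans hϑ).trans ?_
      calc min (1 / 2) (δ / Da) * d ≤ δ / Da * Da :=
            mul_le_mul (min_le_right _ _) hdD hd0 (div_nonneg hδ0.le hDa0.le)
        _ = δ := div_mul_cancel₀ δ hDa0.ne'
    have hY0R : ‖Y₀‖ ≤ (1 + 3 * γ) * Da + 1 := by nlinarith
    have hYsR : ‖Ys‖ ≤ (1 + 3 * γ) * Da + 1 := by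
      have h1 := norm_le_norm_sub_add Ys Y₀
      have h2 : (1 + 3 * γ) * d ≤ (1 + 3 * γ) * Da := mul_le_mul_of_nonneg_left hdD (by positivity)
      linarith
    have hcont := hδ Ys Y₀ hYsR hY0R hclose
    have hrad : rin / 2 ≤ Kerr.radius a (E4.ofTimeSpace 0 Ys) := by
      have := (abs_le.mp hcont).1; linarith
    rw [radius_slice_smul hε0]
    have hεD : Da⁻¹ ≤ ε := by
      rw [hε]; exact inv_anti₀ hm0 (max_le hDa1 hdD)
    calc min (1 / 4) (rin / (2 * Da)) ≤ rin / (2 * Da) := min_le_right _ _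
      _ = Da⁻¹ * (rin / 2) := by field_simp
      _ ≤ ε * Kerr.radius a (E4.ofTimeSpace 0 Ys) :=
          mul_le_mul hεD hrad (by positivity) hε0.le
  · -- far: the scaled spin is small
    have hd1 : 1 < d := lt_of_le_of_lt hDa1 hdD
    have hda : 4 * |a| < d := lt_of_le_of_lt (le_max_right _ _) hdD
    have hεeq : ε = d⁻¹ := by rw [hε, max_eq_right hd1.le]
    have hd0' : 0 < d := by linarith
    refine (min_le_left _ _).trans ?_
    have h14 : (1 : ℝ) / 4 = (1 / 2) / 2 := by norm_num
    rw [h14]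
    refine half_le_radius_slice (by norm_num) ?_ ?_
    · rw [hnε, hεeq, le_inv_mul_iff₀ hd0']; linarith
    · rw [hεeq, abs_mul, abs_of_pos (inv_pos.mpr hd0'), inv_mul_le_iff₀ hd0']; linarith

end OneHole

/-- Registered sub-goal form (stub `oneHole_radius_slice_smul` of the crux item) of
`OneHole.radius_slice_smul`: homogeneity of the rest-frame Kerr–Schild radius (Visser arXiv:0706.0622, (35)).
[folklore] -/
theorem oneHole_radius_slice_smul : open Literature.Geometry.Lorentzian in ∀ {ε : ℝ}, 0 < ε → ∀ (a : ℝ) (w : E3), Kerr.radius (ε * a) (E4.ofTimeSpace 0 (ε • w)) = ε * Kerr.radius a (E4.ofTimeSpace 0 w) :=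
  fun hε a w ↦ OneHole.radius_slice_smul hε a w

end Summit.FinalStateConjecture.FinalStateConjecture.Theorems

end
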